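import Mathlib
import HarnessLib
import Summits.AtomisticToContinuum.HydrodynamicLimit.Theorems.MourreKoopmanChargesOneBodyCompletenessTorusStatics
import Summits.AtomisticToContinuum.HydrodynamicLimit.Theses.FluxGibbsianityLdDrude
import Summits.AtomisticToContinuum.HydrodynamicLimit.Theorems.AntiMazurCoboundariesKineticWindowGronwallThermalScalingFlow
import Summits.AtomisticToContinuum.HydrodynamicLimit.Theorems.AntiMazurCoboundariesKineticWindowGronwallThermalScalingGibbs

/-!
# `OneBodyCompleteness` · line `torus_fejer` v2, stub `stub_coreFejerOfFOME` (the transfer stub)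

Support file for the crux item stmt-AtomisticToContinuum-9583 (`OneBodyCompleteness`, route
`MourreKoopmanCharges` of `AtomisticToContinuum/HydrodynamicLimit`), proving the registered stub
`stub_coreFejerOfFOME` of the skeleton `Cruxes/OneBodyCompleteness/Lines/torus_fejer.lean`:
the existing typed item `FastObservableMeanErgodic` (stmt-AtomisticToContinuum-10952) implies the
open core `stub_coreFejer` of the line, with a `θ`-UNIFORM threshold.

Proof. Apply `FastObservableMeanErgodic` at activity `a = 1`, temperature `θ = 1`, bulk velocity
`u₀ = 0`; its threshold `σ₀ := σ₀^{FOME}(1, 1, 0)` is the core's threshold for every `θ > 0`.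
Given `0 < σ < σ₀`, `θ > 0`, a bounded continuous profile `g` that is `M_θ`-orthogonal to
`1, v, |v|²`, a flow family `Φ`, a wavenumber `n` and `δ > 0`:

* the rescaled profile `g' w := g (√θ w)` is bounded, continuous and `γ`-orthogonal to every
  `c₀ + ⟪b, v⟫ + c₂ |v|²` (`integral_comp_sqrt_smul_stdGaussian`: `∫ G (√θ w) dγ = ∫ G M_θ`, and the
  three `M_θ`-orthogonality relations; integrability by polynomial growth against the Gaussian);
* FOME (second conjunct) for the test function `φ = Re e_n` (resp. `Im e_n`) and `g'` returns a
  window `τ > 0` and `N₀`; for `N ≥ N₀` it is applied to the THERMALLY RESCALED flow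
  `Ψ := thermalScale (Φ N) (√θ)⁻¹` (`KineticWindowGronwallThermalScaling.thermalScale`), and the window
  functional is transported back to `Φ N` and the temperature-`θ` law by
  `KineticWindowGronwallThermalScaling.lintegral_window_thermal`
  (`(scaleVel (√θ)⁻¹)_# G_N(1, 0, θ) = G_N(1, 0, 1)`, `Ψ_s ∘ scaleVel = scaleVel ∘ Φ_{s/√θ}`);
* pointwise, the rescaled observable is `Σᵢ φ(xᵢ) g(vᵢ) = (N+1) · A(z)` (`oneBodyField_eq_sum`), the
  change of variables `s ↦ s (N+1)^{-1/3}` (`intervalIntegral.integral_comp_mul_right`) turns the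
  core's window `T := τ/√θ` into FOME's window `τ (N+1)^{-1/3}` of flow time `· /√θ`, and the two
  squared window averages differ exactly by the factor `(N+1)²`; dividing FOME's bound `δ (N+1)` by
  `(N+1)²` gives the core's bound `δ/(N+1)`.

References: H. Spohn, *Large Scale Dynamics of Interacting Particles* (1991), Part I §7.1
(fluctuation fields, time scales); the thermal scaling of hard-sphere dynamics is folklore
(dimensional analysis). Tree: `thermalScale`, `lintegral_window_thermal`,
`integral_comp_sqrt_smul_stdGaussian`, `oneBodyField_eq_sum`.
-/

noncomputable section

namespace Summit.AtomisticToContinuum.HydrodynamicLimit.Theorems.MourreKoopmanChargesOneBodyCompleteness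

open MeasureTheory ProbabilityTheory Filter Topology Set
open scoped ENNReal BigOperators
open Literature.Analysis.FluidPDE Literature.MathematicalPhysics.KineticTheory
open Summit.AtomisticToContinuum.HydrodynamicLimit.Theses.FluxGibbsianityLdDrude (FastObservableMeanErgodic)
open Summit.AtomisticToContinuum.HydrodynamicLimit.Theorems.MourreKoopmanChargesIdealGasNoDecay
open Summit.AtomisticToContinuum.HydrodynamicLimit.Theorems.KineticWindowGronwallThermalScaling
open UnitAddTorus

namespace StubCoreFejerOfFOMEAux

/-! ### Velocity side: the rescaled profile `w ↦ g (√θ w)` against the standard Gaussian `γ` -/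

/-- Coordinates of the Euclidean inner product on `ℝ³`: `⟪b, v⟫ = Σᵢ vᵢ bᵢ`. [folklore] -/
theorem inner_eq_sum (b v : V3) : inner ℝ b v = ∑ i, v i * b i := by
  simp [EuclideanSpace.inner_eq_star_dotProduct, dotProduct]

/-- `∫ g(√θ w) dγ(w) = 0` from `∫ g M_θ = 0`. [folklore] -/
theorem integral_comp_smul_eq_zero {θ : ℝ} (hθ : 0 < θ) (g : V3 → ℝ)
    (h0 : ∫ v, g v * localMaxwellian 1 θ (0 : V3) v = 0) :
    ∫ w, g (Real.sqrt θ • w) ∂stdGaussian V3 = 0 := by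
  rw [integral_comp_sqrt_smul_stdGaussian hθ g]
  exact h0

/-- `∫ g(√θ w) wᵢ dγ(w) = 0` from `∫ g vᵢ M_θ = 0` (`wᵢ = (√θ)⁻¹ (√θ w)ᵢ`). [folklore] -/
theorem integral_comp_smul_mul_apply_eq_zero {θ : ℝ} (hθ : 0 < θ) (g : V3 → ℝ) (i : Fin 3)
    (h1 : ∫ v, g v * v i * localMaxwellian 1 θ (0 : V3) v = 0) :
    ∫ w, g (Real.sqrt θ • w) * w i ∂stdGaussian V3 = 0 := by
  have hs : 0 < Real.sqrt θ := Real.sqrt_pos.2 hθ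
  have h := integral_comp_sqrt_smul_stdGaussian hθ (fun v => g v * ((Real.sqrt θ)⁻¹ * v i))
  simp only [PiLp.smul_apply, smul_eq_mul, inv_mul_cancel_left₀ hs.ne'] at h
  rw [h]
  have e : ∀ v : V3, g v * ((Real.sqrt θ)⁻¹ * v i) * localMaxwellian 1 θ (0 : V3) v =
      (Real.sqrt θ)⁻¹ * (g v * v i * localMaxwellian 1 θ (0 : V3) v) := fun v => by ring
  simp_rw [e]
  rw [integral_const_mul, h1, mul_zero]

/-- `∫ g(√θ w) |w|² dγ(w) = 0` from `∫ g |v|² M_θ = 0` (`|w|² = θ⁻¹ |√θ w|²`). [folklore] -/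
theorem integral_comp_smul_mul_norm_sq_eq_zero {θ : ℝ} (hθ : 0 < θ) (g : V3 → ℝ)
    (h2 : ∫ v, g v * ‖v‖ ^ 2 * localMaxwellian 1 θ (0 : V3) v = 0) :
    ∫ w, g (Real.sqrt θ • w) * ‖w‖ ^ 2 ∂stdGaussian V3 = 0 := by
  have hs : 0 < Real.sqrt θ := Real.sqrt_pos.2 hθ
  have h := integral_comp_sqrt_smul_stdGaussian hθ (fun v => g v * (θ⁻¹ * ‖v‖ ^ 2))
  simp only [norm_smul, Real.norm_eq_abs, abs_of_pos hs, mul_pow, Real.sq_sqrt hθ.le,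
    inv_mul_cancel_left₀ hθ.ne'] at h
  rw [h]
  have e : ∀ v : V3, g v * (θ⁻¹ * ‖v‖ ^ 2) * localMaxwellian 1 θ (0 : V3) v =
      θ⁻¹ * (g v * ‖v‖ ^ 2 * localMaxwellian 1 θ (0 : V3) v) := fun v => by ring
  simp_rw [e]
  rw [integral_const_mul, h2, mul_zero]

/-- Integrability against `γ` of `g(√θ w) wᵢ` for bounded continuous `g` (linear growth against a
Gaussian measure). [folklore] -/
theorem integrable_comp_smul_mul_apply (θ : ℝ) {g : V3 → ℝ} (hg : Continuous g) {K : ℝ}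
    (hK : ∀ v, |g v| ≤ K) (i : Fin 3) :
    Integrable (fun w : V3 => g (Real.sqrt θ • w) * w i) (stdGaussian V3) := by
  have hK0 : 0 ≤ K := (abs_nonneg _).trans (hK 0)
  have hgc : Continuous fun w : V3 => g (Real.sqrt θ • w) := hg.comp (continuous_const_smul _)
  refine integrable_of_poly_growth (stdGaussian V3) (hgc.mul (PiLp.continuous_apply 2 _ i)).aestronglyMeasurable
    (C := K) (k := 1) fun v => ?_
  rw [abs_mul, pow_one]
  have hvi : |v i| ≤ 1 + ‖v‖ := by
    have h := PiLp.norm_apply_le v i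
    rw [Real.norm_eq_abs] at h
    linarith [norm_nonneg v]
  exact mul_le_mul (hK _) hvi (abs_nonneg _) hK0

/-- Integrability against `γ` of `g(√θ w) |w|²` for bounded continuous `g` (quadratic growth against a
Gaussian measure). [folklore] -/
theorem integrable_comp_smul_mul_norm_sq (θ : ℝ) {g : V3 → ℝ} (hg : Continuous g) {K : ℝ}
    (hK : ∀ v, |g v| ≤ K) :
    Integrable (fun w : V3 => g (Real.sqrt θ • w) * ‖w‖ ^ 2) (stdGaussian V3) := by
  have hK0 : 0 ≤ K := (abs_nonneg _).trans (hK 0)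
  have hgc : Continuous fun w : V3 => g (Real.sqrt θ • w) := hg.comp (continuous_const_smul _)
  refine integrable_of_poly_growth (stdGaussian V3) (hgc.mul (continuous_norm.pow 2)).aestronglyMeasurable
    (C := K) (k := 2) fun v => ?_
  rw [abs_mul, abs_pow, abs_norm]
  exact mul_le_mul (hK _) (pow_le_pow_left₀ (norm_nonneg _) (by linarith [norm_nonneg v]) 2)
    (by positivity) hK0

/-- Integrability against `γ` of `g(√θ w)` for bounded continuous `g`. [folklore] -/
theorem integrable_comp_smul (θ : ℝ) {g : V3 → ℝ} (hg : Continuous g) {K : ℝ} (hK : ∀ v, |g v| ≤ K) :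
    Integrable (fun w : V3 => g (Real.sqrt θ • w)) (stdGaussian V3) :=
  integrable_of_poly_growth (stdGaussian V3) ((hg.comp (continuous_const_smul _)).aestronglyMeasurable)
    (C := K) (k := 0) fun v => by rw [pow_zero, mul_one]; exact hK _

/-- **Orthogonality transfer.** A bounded continuous `g` that is `M_θ`-orthogonal to `1, vᵢ, |v|²`
has a rescaled profile `w ↦ g(√θ w)` that is `γ`-orthogonal to every `c₀ + ⟪b, v⟫ + c₂ |v|²` (the
orthogonality clause of `FastObservableMeanErgodic`). [folklore] -/
theorem orth_transfer {θ : ℝ} (hθ : 0 < θ) {g : V3 → ℝ} (hg : Continuous g) {K : ℝ}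
    (hK : ∀ v, |g v| ≤ K) (h0 : ∫ v, g v * localMaxwellian 1 θ (0 : V3) v = 0)
    (h1 : ∀ i : Fin 3, ∫ v, g v * v i * localMaxwellian 1 θ (0 : V3) v = 0)
    (h2 : ∫ v, g v * ‖v‖ ^ 2 * localMaxwellian 1 θ (0 : V3) v = 0) :
    ∀ (c₀ c₂ : ℝ) (b : V3),
      ∫ v, g (Real.sqrt θ • v) * (c₀ + inner ℝ b v + c₂ * ‖v‖ ^ 2) ∂stdGaussian V3 = 0 := by
  intro c₀ c₂ b
  have J0 := integrable_comp_smul θ hg hK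
  have J1 := integrable_comp_smul_mul_apply θ hg hK
  have J2 := integrable_comp_smul_mul_norm_sq θ hg hK
  have e₁ : ∀ w : V3, g (Real.sqrt θ • w) * inner ℝ b w =
      ∑ i, b i * (g (Real.sqrt θ • w) * w i) := by
    intro w
    rw [inner_eq_sum, Finset.mul_sum]
    exact Finset.sum_congr rfl fun i _ => by ring
  have Jinner : Integrable (fun w : V3 => g (Real.sqrt θ • w) * inner ℝ b w) (stdGaussian V3) := by
    simp_rw [e₁]
    exact integrable_finsetSum _ fun i _ => (J1 i).const_mul (b i)
  have Iinner : ∫ w, g (Real.sqrt θ • w) * inner ℝ b w ∂stdGaussian V3 = 0 := by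
    simp_rw [e₁]
    rw [integral_finsetSum _ fun i _ => (J1 i).const_mul (b i)]
    exact Finset.sum_eq_zero fun i _ => by
      rw [integral_const_mul, integral_comp_smul_mul_apply_eq_zero hθ g i (h1 i), mul_zero]
  have e : ∀ w : V3, g (Real.sqrt θ • w) * (c₀ + inner ℝ b w + c₂ * ‖w‖ ^ 2) =
      c₀ * g (Real.sqrt θ • w) + g (Real.sqrt θ • w) * inner ℝ b w +
        c₂ * (g (Real.sqrt θ • w) * ‖w‖ ^ 2) := fun w => by ring
  have J01 : Integrable (fun w : V3 => c₀ * g (Real.sqrt θ • w) + g (Real.sqrt θ • w) * inner ℝ b w)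
      (stdGaussian V3) := (J0.const_mul c₀).add Jinner
  simp_rw [e]
  rw [integral_add J01 (J2.const_mul c₂), integral_add (J0.const_mul c₀) Jinner, integral_const_mul,
    integral_const_mul, integral_comp_smul_eq_zero hθ g h0, Iinner,
    integral_comp_smul_mul_norm_sq_eq_zero hθ g h2]
  ring

/-! ### Configuration side: the rescaled one-body observable and the window algebra -/

/-- The FOME observable of the rescaled profile, evaluated at a velocity-rescaled configuration, is
`(N+1)` times the one-body empirical field: `Σᵢ φ(xᵢ) g(s · (√1)⁻¹ (s⁻¹ vᵢ - 0)) = (N+1) A(w)`.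
[folklore] -/
theorem sum_scaleVel_eq {N : ℕ} (φ : T3 → ℝ) (g : V3 → ℝ) {s : ℝ} (hs : s ≠ 0)
    (w : Config (N + 1) (Fin 3) T3) :
    ∑ i, φ ((scaleVel s⁻¹ w) i).1 * g (s • ((Real.sqrt 1)⁻¹ • (((scaleVel s⁻¹ w) i).2 - 0))) =
      ((N : ℝ) + 1) * ∫ y, φ y.1 * g y.2 ∂(empiricalMeasure w) := by
  rw [oneBodyField_eq_sum φ g w, Nat.cast_add_one,
    mul_inv_cancel_left₀ (by positivity : ((N : ℝ) + 1) ≠ 0)]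
  refine Finset.sum_congr rfl fun i _ => ?_
  simp only [scaleVel_apply, Real.sqrt_one, inv_one, one_smul, sub_zero, smul_inv_smul₀ hs]

/-- **Window algebra** (pure real analysis): after `x ↦ x c` the core's window average over `[0, s⁻¹ τ]`
of `u ↦ a(u c)` and FOME's window average over `[0, τ c]` of flow time `·/s… ` of `n · a` have squares
in the ratio `n²`. [folklore] -/
theorem window_sq_rescale (a : ℝ → ℝ) {s τ c n : ℝ} (hs : s ≠ 0) (hτ : τ ≠ 0) (hc : c ≠ 0) (hn : n ≠ 0) :
    ((s⁻¹ * τ)⁻¹ * ∫ x in (0 : ℝ)..(s⁻¹ * τ), a (x * c)) ^ 2 =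
      (n ^ 2)⁻¹ * ((τ * c)⁻¹ * (s⁻¹⁻¹ * ∫ u in (s⁻¹ * 0)..(s⁻¹ * (τ * c)), n * a u)) ^ 2 := by
  rw [intervalIntegral.integral_comp_mul_right a hc, intervalIntegral.integral_const_mul, zero_mul,
    mul_zero, inv_inv, smul_eq_mul, show s⁻¹ * τ * c = s⁻¹ * (τ * c) by ring]
  field_simp

/-- **Pointwise identity between the two window functionals** (core window `T = τ/√θ` in Euler time
`s (N+1)^{-1/3}` of `Φ` versus FOME's window `τ (N+1)^{-1/3}` of the rescaled flow, transported):
the squared core average is `(N+1)⁻²` times the squared transported FOME average. [folklore] -/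
theorem integrand_rescale {σ : ℝ} {N : ℕ}
    (Φ : HardSphereFlow (Torus.geometry (Fin 3)) (hsDiameter σ N) (N + 1)) (φ : T3 → ℝ) (g : V3 → ℝ)
    {s τ : ℝ} (hs : s ≠ 0) (hτ : τ ≠ 0) (z : Config (N + 1) (Fin 3) T3) :
    ((s⁻¹ * τ)⁻¹ * ∫ x in (0 : ℝ)..(s⁻¹ * τ),
        ∫ y, φ y.1 * g y.2 ∂(empiricalMeasure (Φ.flow (x * ((N : ℝ) + 1) ^ (-(1 / 3 : ℝ))) z))) ^ 2 =
      (((N : ℝ) + 1) ^ 2)⁻¹ * ((τ * ((N + 1 : ℕ) : ℝ) ^ (-(1 / 3 : ℝ)))⁻¹ * (s⁻¹⁻¹ *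
        ∫ u in (s⁻¹ * 0)..(s⁻¹ * (τ * ((N + 1 : ℕ) : ℝ) ^ (-(1 / 3 : ℝ)))),
          ∑ i, φ ((scaleVel s⁻¹ (Φ.flow u z)) i).1 *
            g (s • ((Real.sqrt 1)⁻¹ • (((scaleVel s⁻¹ (Φ.flow u z)) i).2 - 0))))) ^ 2 := by
  simp only [sum_scaleVel_eq φ g hs]
  rw [Nat.cast_add_one]
  exact window_sq_rescale (fun u => ∫ y, φ y.1 * g y.2 ∂(empiricalMeasure (Φ.flow u z))) hs hτ
    (Real.rpow_pos_of_pos (by positivity) _).ne' (by positivity)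

/-- Scaling a bound in the `∫⁻ ofReal` currency: if `f = k g` pointwise with `k ≥ 0` and
`∫⁻ ofReal g ≤ ofReal B`, then `∫⁻ ofReal f ≤ ofReal (k B)`. [folklore] -/
theorem lintegral_ofReal_le_of_eq_mul {α : Type*} [MeasurableSpace α] {μ : Measure α} {f g : α → ℝ}
    {k B : ℝ} (hk : 0 ≤ k) (hfg : ∀ z, f z = k * g z)
    (hg : ∫⁻ z, ENNReal.ofReal (g z) ∂μ ≤ ENNReal.ofReal B) :
    ∫⁻ z, ENNReal.ofReal (f z) ∂μ ≤ ENNReal.ofReal (k * B) := by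
  calc ∫⁻ z, ENNReal.ofReal (f z) ∂μ = ∫⁻ z, ENNReal.ofReal k * ENNReal.ofReal (g z) ∂μ :=
        lintegral_congr fun z => by rw [hfg, ENNReal.ofReal_mul hk]
    _ = ENNReal.ofReal k * ∫⁻ z, ENNReal.ofReal (g z) ∂μ :=
        lintegral_const_mul' _ _ ENNReal.ofReal_ne_top
    _ ≤ ENNReal.ofReal k * ENNReal.ofReal B := mul_le_mul_right hg _
    _ = ENNReal.ofReal (k * B) := (ENNReal.ofReal_mul hk).symm

/-- **The transfer for one continuous test function.** From the unit-temperature FOME bound for `φ`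
and the rescaled profile `w ↦ g(√θ w)` (all `N ≥ N₀`, all flows), the core's Fejér decay for `φ`, `g`
at temperature `θ` along any flow family `Φ`, with window `T := τ/√θ`: FOME is applied to the
thermally rescaled flow `thermalScale (Φ N) (√θ)⁻¹`, transported by `lintegral_window_thermal`, and
the pointwise identity `integrand_rescale` is integrated. [folklore; tree: thermalScale,
lintegral_window_thermal] -/
theorem fejer_of_unit {σ θ : ℝ} (hθ : 0 < θ) (φ : T3 → ℝ) (g : V3 → ℝ)
    (hU : ∀ δ : ℝ, 0 < δ → ∃ τ : ℝ, 0 < τ ∧ ∃ N₀ : ℕ, ∀ N : ℕ, N₀ ≤ N →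
      ∀ Ψ : HardSphereFlow (Torus.geometry (Fin 3)) (hsDiameter σ N) (N + 1),
        ∫⁻ z, ENNReal.ofReal (((τ * ((N + 1 : ℕ) : ℝ) ^ (-(1 / 3 : ℝ)))⁻¹ *
            ∫ s in (0 : ℝ)..(τ * ((N + 1 : ℕ) : ℝ) ^ (-(1 / 3 : ℝ))),
              ∑ i, φ (Ψ.flow s z i).1 *
                g (Real.sqrt θ • ((Real.sqrt 1)⁻¹ • ((Ψ.flow s z i).2 - 0)))) ^ 2)
          ∂(localGibbsLaw σ (fun _ => 1) (fun _ => 0) (fun _ => 1) N Ψ) ≤ ENNReal.ofReal (δ * (N + 1)))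
    (Φ : (N : ℕ) → HardSphereFlow (Torus.geometry (Fin 3)) (hsDiameter σ N) (N + 1)) :
    ∀ δ : ℝ, 0 < δ → ∃ T : ℝ, 0 < T ∧ ∃ N₀ : ℕ, ∀ N : ℕ, N₀ ≤ N →
      ∫⁻ z, ENNReal.ofReal ((T⁻¹ * ∫ s in (0 : ℝ)..T,
          ∫ y, φ y.1 * g y.2
            ∂(empiricalMeasure ((Φ N).flow (s * ((N : ℝ) + 1) ^ (-(1 / 3 : ℝ))) z))) ^ 2)
        ∂(localGibbsLaw σ (fun _ => 1) (fun _ => 0) (fun _ => θ) N (Φ N))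
        ≤ ENNReal.ofReal (δ / ((N : ℝ) + 1)) := by
  intro δ hδ
  obtain ⟨τ, hτ, N₀, hN⟩ := hU δ hδ
  have hs : 0 < Real.sqrt θ := Real.sqrt_pos.2 hθ
  refine ⟨(Real.sqrt θ)⁻¹ * τ, mul_pos (inv_pos.2 hs) hτ, N₀, fun N hNN => ?_⟩
  have hk : (0 : ℝ) ≤ (((N : ℝ) + 1) ^ 2)⁻¹ := by positivity
  have hΨ : ∀ t z, (thermalScale (Φ N) (Real.sqrt θ)⁻¹ (inv_pos.2 hs)).flow t z =
      scaleVel (Real.sqrt θ)⁻¹ ((Φ N).flow ((Real.sqrt θ)⁻¹ * t) (scaleVel (Real.sqrt θ)⁻¹⁻¹ z)) :=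
    fun t z => rfl
  have hB := (lintegral_window_thermal σ 1 hθ N (Φ N) (thermalScale (Φ N) (Real.sqrt θ)⁻¹ (inv_pos.2 hs))
    hΨ (fun x => ENNReal.ofReal (((τ * ((N + 1 : ℕ) : ℝ) ^ (-(1 / 3 : ℝ)))⁻¹ * x) ^ 2))
    (fun w => ∑ i, φ (w i).1 * g (Real.sqrt θ • ((Real.sqrt 1)⁻¹ • ((w i).2 - 0)))) 0
    (τ * ((N + 1 : ℕ) : ℝ) ^ (-(1 / 3 : ℝ)))).symm.trans_le
      (hN N hNN (thermalScale (Φ N) (Real.sqrt θ)⁻¹ (inv_pos.2 hs)))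
  refine (lintegral_ofReal_le_of_eq_mul hk (fun z => integrand_rescale (Φ N) φ g hs.ne' hτ.ne' z)
    hB).trans_eq ?_
  congr 1
  field_simp

end StubCoreFejerOfFOMEAux

/-- **STUB S4' — TRANSFER** (`stub_coreFejerOfFOME` of line `torus_fejer` v2 of crux
stmt-AtomisticToContinuum-9583): the existing typed item `FastObservableMeanErgodic`
(stmt-AtomisticToContinuum-10952) implies the torus Fejér core `stub_coreFejer`, with the `θ`-UNIFORM
threshold `σ₀ := σ₀^{FOME}(a = 1, θ = 1, u₀ = 0)`: apply FOME at unit temperature to the thermally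
rescaled flow `thermalScale (Φ N) (√θ)⁻¹` and the profile `g(√θ ·)` (bounded, continuous,
`γ`-orthogonal to `c₀ + ⟪b, v⟫ + c₂|v|²` by `integral_comp_sqrt_smul_stdGaussian` and the three
`M_θ`-orthogonality relations), transport the window functional back with
`KineticWindowGronwallThermalScaling.lintegral_window_thermal`, change variables `s ↦ s(N+1)^{-1/3}`,
window `T := τ/√θ`, and divide by `(N+1)²`.
[Spohn1991 §7.1; tree: thermalScale, lintegral_window_thermal, integral_comp_sqrt_smul_stdGaussian] -/
theorem stub_coreFejerOfFOME : FastObservableMeanErgodic →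
    ∃ σ₀ : ℝ, 0 < σ₀ ∧ ∀ σ : ℝ, 0 < σ → σ < σ₀ → ∀ θ : ℝ, 0 < θ →
      ∀ g : V3 → ℝ, Continuous g → (∃ K : ℝ, ∀ v, |g v| ≤ K) →
        (∫ v, g v * localMaxwellian 1 θ (0 : V3) v = 0) →
        (∀ i : Fin 3, ∫ v, g v * v i * localMaxwellian 1 θ (0 : V3) v = 0) →
        (∫ v, g v * ‖v‖ ^ 2 * localMaxwellian 1 θ (0 : V3) v = 0) →
        ∀ (Φ : (N : ℕ) → HardSphereFlow (Torus.geometry (Fin 3)) (hsDiameter σ N) (N + 1))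
          (n : Fin 3 → ℤ),
          (∀ δ : ℝ, 0 < δ → ∃ T : ℝ, 0 < T ∧ ∃ N₀ : ℕ, ∀ N : ℕ, N₀ ≤ N →
            ∫⁻ z, ENNReal.ofReal ((T⁻¹ * ∫ s in (0 : ℝ)..T,
                ∫ y, (mFourier n y.1).re * g y.2
                  ∂(empiricalMeasure ((Φ N).flow (s * ((N : ℝ) + 1) ^ (-(1 / 3 : ℝ))) z))) ^ 2)
              ∂(localGibbsLaw σ (fun _ => 1) (fun _ => 0) (fun _ => θ) N (Φ N))
              ≤ ENNReal.ofReal (δ / ((N : ℝ) + 1))) ∧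
          (∀ δ : ℝ, 0 < δ → ∃ T : ℝ, 0 < T ∧ ∃ N₀ : ℕ, ∀ N : ℕ, N₀ ≤ N →
            ∫⁻ z, ENNReal.ofReal ((T⁻¹ * ∫ s in (0 : ℝ)..T,
                ∫ y, (mFourier n y.1).im * g y.2
                  ∂(empiricalMeasure ((Φ N).flow (s * ((N : ℝ) + 1) ^ (-(1 / 3 : ℝ))) z))) ^ 2)
              ∂(localGibbsLaw σ (fun _ => 1) (fun _ => 0) (fun _ => θ) N (Φ N))
              ≤ ENNReal.ofReal (δ / ((N : ℝ) + 1))) := by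
  intro hFOME
  obtain ⟨σ₀, hσ₀, hσ⟩ := hFOME 1 1 0 one_pos one_pos
  refine ⟨σ₀, hσ₀, fun σ hσpos hσlt θ hθ g hg hgK h0 h1 h2 Φ n => ?_⟩
  obtain ⟨K, hK⟩ := hgK
  have hU := (hσ σ hσpos hσlt).2
  have hg' : Continuous fun w : V3 => g (Real.sqrt θ • w) := hg.comp (continuous_const_smul _)
  have hK' : ∃ K : ℝ, ∀ v : V3, |g (Real.sqrt θ • v)| ≤ K := ⟨K, fun v => hK _⟩
  have horth := StubCoreFejerOfFOMEAux.orth_transfer hθ hg hK h0 h1 h2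
  exact ⟨StubCoreFejerOfFOMEAux.fejer_of_unit hθ (fun x => (mFourier n x).re) g
      (hU (fun x => (mFourier n x).re) (fun w => g (Real.sqrt θ • w))
        (Complex.continuous_re.comp (mFourier n).continuous) hg' hK' horth) Φ,
    StubCoreFejerOfFOMEAux.fejer_of_unit hθ (fun x => (mFourier n x).im) g
      (hU (fun x => (mFourier n x).im) (fun w => g (Real.sqrt θ • w))
        (Complex.continuous_im.comp (mFourier n).continuous) hg' hK' horth) Φ⟩

end Summit.AtomisticToContinuum.HydrodynamicLimit.Theorems.MourreKoopmanChargesOneBodyCompleteness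

end
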